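import Literature.Topology.PlanarFoliations.HugFrameStep
import HarnessLib

/-!
# The hugged walk of a hugging frame is eventually periodic

Topic: Topology / PlanarFoliations, the generic form of `HugOrbit.lean` over a hugging frame
(`HugFrameStep.lean`). Verbatim port: all states of the hugged walk are good, so each state is the
canonical next state of the previous one, a function of its out-dart
(`FData.next_eq_of_outDart_eq`); the darts are finitely many (`Dart.finite`), so a dart repeats
and **the sequence of states is eventually periodic, literally** (`FData.exists_period`); a
minimal period has **pairwise distinct darts** (`FData.exists_min_period`). (The periodic part as
a closed walk is set up as cycle data in `FrameOrbitCycle.lean`.)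

## References

* C. Camacho, A. Lins Neto, *Geometric Theory of Foliations*, Birkhäuser (1985), Ch. VII §2
  [CamachoLinsNeto1985].
-/

noncomputable section

open Set Filter Function Metric unitInterval
open _root_.Topology
open Literature.Topology.FourManifolds Literature.Topology.FourManifolds.Foliation

namespace Literature.Topology.PlanarFoliations

namespace StarData

variable {X : Type*} [TopologicalSpace X] [T2Space X] [SecondCountableTopology X] [Nonempty X] {F : Foliation ℝ X} {ι : X → ℂ}
variable {B : Type*} [NormedAddCommGroup B] [NormedSpace ℝ B] {M : Type*} [TopologicalSpace M] {T : Foliation B M} {g : ℂ → M}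
variable {D : StarData F ι T g} {hbi : IsBiOriented F} {hι : IsOpenEmbedding ι} {C G : Set ℂ} {A : ℕ → X} {Fr : D.HugFrame hbi hι C G A}

namespace FData

variable (ho : F.IsTransverselyOriented) {s : ℝ} (fd₀ : FData Fr)

omit [NormedSpace ℝ B] in
/-- Equal states have equal successors. [folklore] -/
theorem seq_succ_congr (s : ℝ) {k k' : ℕ} (h : seq s fd₀ k = seq s fd₀ k') : seq s fd₀ (k + 1) = seq s fd₀ (k' + 1) := by
  rw [seq_succ, seq_succ, h]

omit [NormedSpace ℝ B] in
/-- Equal states have equal futures. [folklore] -/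
theorem seq_add_congr (s : ℝ) {k k' : ℕ} (h : seq s fd₀ k = seq s fd₀ k') (i : ℕ) : seq s fd₀ (k + i) = seq s fd₀ (k' + i) := by
  induction i with
  | zero => exact h
  | succ i ih => exact seq_succ_congr fd₀ s ih

include ho in
/-- **The sequence of states of the hugged walk is eventually periodic** (literally): a dart
repeats, the next states coincide, and so do all later ones. [folklore] -/
theorem exists_period (hs : s = 1 ∨ s = -1) (hcross : fd₀.Cross s) :
    ∃ c p : ℕ, 0 < p ∧ ∀ i, seq s fd₀ (c + i + p) = seq s fd₀ (c + i) := by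
  haveI := Dart.finite (D := D)
  have aux : ∀ {a b : ℕ}, a < b → (seq s fd₀ a).dart = (seq s fd₀ b).dart →
      ∃ c p : ℕ, 0 < p ∧ ∀ i, seq s fd₀ (c + i + p) = seq s fd₀ (c + i) := by
    intro a b hab heq
    have hout : (seq s fd₀ a).outDart s = (seq s fd₀ b).outDart s := by
      show (seq s fd₀ a).dart.turn s = (seq s fd₀ b).dart.turn s
      rw [heq]
    have h1 : seq s fd₀ (a + 1) = seq s fd₀ (b + 1) :=
      outDart_seq_succ_eq s fd₀ hout (good_seq ho fd₀ hs hcross a) (good_seq ho fd₀ hs hcross b)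
    refine ⟨a + 1, b - a, Nat.sub_pos_of_lt hab, fun i ↦ ?_⟩
    have : a + 1 + i + (b - a) = b + 1 + i := by omega
    rw [this]
    exact (seq_add_congr fd₀ s h1 i).symm
  obtain ⟨a, b, hab, heq⟩ := Finite.exists_ne_map_eq_of_infinite (fun k : ℕ ↦ (seq s fd₀ k).dart)
  rcases lt_or_gt_of_ne hab with h | h
  · exact aux h heq
  · exact aux h heq.symm

include ho in
/-- **A minimal period of the hugged walk has pairwise distinct darts.** [folklore] -/
theorem exists_min_period (hs : s = 1 ∨ s = -1) (hcross : fd₀.Cross s) :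
    ∃ c p : ℕ, 0 < p ∧ (∀ i, seq s fd₀ (c + i + p) = seq s fd₀ (c + i)) ∧
      ∀ i j, i < j → j < p → (seq s fd₀ (c + i)).dart ≠ (seq s fd₀ (c + j)).dart := by
  classical
  have hex : ∃ p, ∃ c : ℕ, 0 < p ∧ ∀ i, seq s fd₀ (c + i + p) = seq s fd₀ (c + i) := by
    obtain ⟨c, p, hp, hper⟩ := exists_period ho fd₀ hs hcross
    exact ⟨p, c, hp, hper⟩
  set p := Nat.find hex with hpdef
  obtain ⟨c, hp, hper⟩ : ∃ c : ℕ, 0 < p ∧ ∀ i, seq s fd₀ (c + i + p) = seq s fd₀ (c + i) := Nat.find_spec hex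
  refine ⟨c, p, hp, hper, fun i j hij hjp heq ↦ ?_⟩
  -- a repetition inside the period gives a shorter period
  have hout : (seq s fd₀ (c + i)).outDart s = (seq s fd₀ (c + j)).outDart s := by
    show (seq s fd₀ (c + i)).dart.turn s = (seq s fd₀ (c + j)).dart.turn s
    rw [heq]
  have h1 : seq s fd₀ (c + i + 1) = seq s fd₀ (c + j + 1) :=
    outDart_seq_succ_eq s fd₀ hout (good_seq ho fd₀ hs hcross _) (good_seq ho fd₀ hs hcross _)
  have hmin : ¬ (j - i < p ∧ ∃ c' : ℕ, 0 < j - i ∧ ∀ k, seq s fd₀ (c' + k + (j - i)) = seq s fd₀ (c' + k)) := by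
    rintro ⟨hlt, hP⟩
    exact Nat.find_min hex hlt hP
  refine hmin ⟨by omega, c + i + 1, Nat.sub_pos_of_lt hij, fun k ↦ ?_⟩
  have : c + i + 1 + k + (j - i) = c + j + 1 + k := by omega
  rw [this]
  exact (seq_add_congr fd₀ s h1 k).symm

end FData

end StarData

end Literature.Topology.PlanarFoliations
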